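import Literature.NumberTheory.Transcendental.BakerLogarithms
import HarnessLib

/-!
# Baker's theorem — proof of Lemma 6 (the Liouville-type lower bound)

Trunk T-TRANSCEND, family `periods`, fact `Literature.NumberTheory.Transcendental.baker`; this file discharges the named fact
`Literature.NumberTheory.Transcendental.Baker1975.Lemma6` of `BakerLogarithms.lean`:

**Baker 1975, Ch. 2, Lemma 6** (p. 24). Let `l₁, …, lₙ` be logarithms of algebraic numbers
(`αᵢ = e^{lᵢ}` algebraic), linearly independent over `ℚ`. There is `c > 0` such that for all
integers `t₁, …, tₙ`, not all zero, of absolute value at most `T`,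
`|t₁ l₁ + ⋯ + tₙ lₙ| > c^{-T}`.

## Proof (following the source, pp. 24–25)

Let `K = ℚ(α₁, …, αₙ) ⊆ ℂ` (a number field) and `D ∈ ℤ ∖ {0}` with every `D αᵢ` an algebraic
integer. Write `tᵢ = pᵢ - mᵢ` with `pᵢ, mᵢ ≥ 0`, `pᵢ + mᵢ = |tᵢ|`, and put
`ω = ∏ (D αᵢ)^{pᵢ} ∏ D^{mᵢ} - ∏ (D αᵢ)^{mᵢ} ∏ D^{pᵢ} = D^{∑|tᵢ|} ∏ αᵢ^{mᵢ} (e^{Ω} - 1)`,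
`Ω = ∑ tᵢ lᵢ`, an algebraic integer of `K` all of whose conjugates are `≤ 2 (|D| M)^{nT}` in
absolute value (`M ≥ 1` bounding all conjugates of the `αᵢ`). `Ω ≠ 0` by the independence
hypothesis. If `|Ω| > 1` there is nothing to prove. If `ω = 0` then `e^{Ω} = 1`, so `Ω` is a
non-zero multiple of `2πi` and `|Ω| ≥ 2π`. Otherwise the norm of `ω` is a non-zero rational
integer, so `1 ≤ |N(ω)| ≤ |ω| (2(|D|M)^{nT})^{h}` (`h` = number of embeddings `K → ℂ`), while
`|ω| ≤ 2 (|D|M)^{nT} |Ω|` by `|e^z - 1| ≤ 2|z|` (`|z| ≤ 1`); hence `|Ω| ≥ c^{-T}` with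
`c = 2 · 2^{h+1} (|D| M)^{n(h+1)}` (the extra factor `2` makes the inequality strict).

Mathlib supplies: `IntermediateField.adjoin`, `Algebra.norm_eq_prod_embeddings`,
`Algebra.isIntegral_norm`, `IsIntegrallyClosed.isIntegral_iff` (for `ℤ`),
`IsAlgebraic.exists_integral_multiple`, `Complex.exp_eq_one_iff`, `Complex.norm_exp_sub_one_le`.

## References

* [Baker1975] A. Baker, *Transcendental Number Theory*, Cambridge Univ. Press, 1975, Ch. 2,
  Lemma 6, pp. 24–25.
-/

noncomputable section

open Complex Finset

namespace Literature.NumberTheory.Transcendental.Baker1975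

/-! ### Auxiliary material (namespace `L6`) -/

namespace L6

/-! Step 1: the number field generated by the `α i = e^{l i}` and a common denominator. -/

variable {n : ℕ}

/-- The field `ℚ(α₁, …, αₙ)` as an intermediate field of `ℂ / ℚ`. [folklore] -/
def fld (α : Fin n → ℂ) : IntermediateField ℚ ℂ := IntermediateField.adjoin ℚ (Set.range α)

/-- The generators lie in `fld α`. [folklore] -/
theorem mem_fld (α : Fin n → ℂ) (i : Fin n) : α i ∈ fld α :=
  IntermediateField.subset_adjoin _ _ ⟨i, rfl⟩

/-- `ℚ(α₁, …, αₙ)/ℚ` is finite when the `αᵢ` are algebraic. [folklore] -/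
theorem finiteDimensional_fld (α : Fin n → ℂ) (halg : ∀ i, IsAlgebraic ℚ (α i)) :
    FiniteDimensional ℚ (fld α) := by
  haveI : Finite (Set.range α) := Set.finite_range α |>.to_subtype
  exact IntermediateField.finiteDimensional_adjoin fun x hx => by
    obtain ⟨i, rfl⟩ := hx
    exact (halg i).isIntegral

/-- A common denominator: `D ≠ 0` in `ℤ` with `D αᵢ` an algebraic integer for every `i` (Baker's
leading coefficients `a_j`, p. 24). [cite: Baker1975, Ch. 2 Lemma 6] -/
theorem exists_den (α : Fin n → ℂ) (halg : ∀ i, IsAlgebraic ℚ (α i)) :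
    ∃ D : ℤ, D ≠ 0 ∧ ∀ i, IsIntegral ℤ ((D : ℂ) * α i) := by
  have h1 : ∀ i, ∃ y : ℤ, y ≠ 0 ∧ IsIntegral ℤ ((y : ℂ) * α i) := by
    intro i
    have hz : IsAlgebraic ℤ (α i) := (IsFractionRing.isAlgebraic_iff ℤ ℚ ℂ).mpr (halg i)
    obtain ⟨y, hy, hint⟩ := hz.exists_integral_multiple
    refine ⟨y, hy, ?_⟩
    simpa [zsmul_eq_mul] using hint
  choose y hy hint using h1
  refine ⟨∏ i, y i, prod_ne_zero_iff.mpr fun i _ => hy i, fun i => ?_⟩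
  classical
  rw [← mul_prod_erase univ y (mem_univ i)]
  push_cast
  rw [mul_comm ((y i : ℂ)) _, mul_assoc]
  have h2 : IsIntegral ℤ (((∏ j ∈ univ.erase i, y j : ℤ) : ℂ)) := by
    exact_mod_cast isIntegral_algebraMap (R := ℤ) (A := ℂ) (x := ∏ j ∈ univ.erase i, y j)
  simpa using h2.mul (hint i)

/-! Step 2: the norm ("Liouville") inequality in a number field `K ⊆ ℂ`. -/

/-- If `ω ≠ 0` is an algebraic integer of `K ⊆ ℂ`, `[K : ℚ] < ∞`, all of whose conjugates have
absolute value at most `B ≥ 1`, then `1 ≤ |ω| · B^h`, `h` the number of embeddings `K → ℂ`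
(the norm of `ω` is a non-zero rational integer). [folklore] -/
theorem one_le_norm_mul_pow (K : IntermediateField ℚ ℂ) [FiniteDimensional ℚ K] {ω : K}
    (hint : IsIntegral ℤ ω) (hω : ω ≠ 0) {B : ℝ} (hB : 1 ≤ B)
    (hconj : ∀ σ : K →ₐ[ℚ] ℂ, ‖σ ω‖ ≤ B) :
    1 ≤ ‖(ω : ℂ)‖ * B ^ Fintype.card (K →ₐ[ℚ] ℂ) := by
  classical
  set N := Algebra.norm ℚ ω with hN
  have hN0 : N ≠ 0 := Algebra.norm_ne_zero_iff.mpr hω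
  have hNint : IsIntegral ℤ N := Algebra.isIntegral_norm ℚ hint
  obtain ⟨m, hm⟩ := IsIntegrallyClosed.isIntegral_iff.mp hNint
  have hm' : (m : ℚ) = N := by simpa using hm
  have hm0 : m ≠ 0 := by rintro rfl; simp at hm'; exact hN0 hm'.symm
  have h1 : (1 : ℝ) ≤ ‖(algebraMap ℚ ℂ N)‖ := by
    rw [← hm']
    simp only [eq_ratCast, Rat.cast_intCast, Complex.norm_intCast]
    exact_mod_cast Int.one_le_abs hm0
  have h2 : algebraMap ℚ ℂ N = ∏ σ : K →ₐ[ℚ] ℂ, σ ω := Algebra.norm_eq_prod_embeddings ℚ ℂ ω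
  rw [h2, norm_prod, ← mul_prod_erase univ (fun σ : K →ₐ[ℚ] ℂ => ‖σ ω‖) (mem_univ K.val)] at h1
  have h3 : ∏ σ ∈ univ.erase K.val, ‖σ ω‖ ≤ B ^ Fintype.card (K →ₐ[ℚ] ℂ) := by
    refine (prod_le_prod (fun σ _ => norm_nonneg _) fun σ _ => hconj σ).trans ?_
    rw [prod_const]
    exact pow_le_pow_right₀ hB (card_erase_le.trans (Finset.card_univ).le)
  calc (1 : ℝ) ≤ ‖K.val ω‖ * ∏ σ ∈ univ.erase K.val, ‖σ ω‖ := h1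
    _ ≤ ‖(ω : ℂ)‖ * B ^ Fintype.card (K →ₐ[ℚ] ℂ) := by
        exact mul_le_mul_of_nonneg_left h3 (norm_nonneg _)


/-! Step 3: the main estimate. -/

/-- Lemma 6 with the statement spelled out (see `lemma6_holds`). [cite: Baker1975, Ch. 2 Lemma 6] -/
theorem lemma6_holds_aux (n : ℕ) (l : Fin n → ℂ) (halg : ∀ i, IsAlgebraic ℚ (cexp (l i)))
    (hli : LinearIndependent ℚ l) :
    ∃ c : ℝ, 0 < c ∧ ∀ (T : ℕ) (t : Fin n → ℤ), t ≠ 0 → (∀ i, |t i| ≤ T) →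
      (c ^ T)⁻¹ < ‖∑ i, (t i : ℂ) * l i‖ := by
  classical
  set α : Fin n → ℂ := fun i => cexp (l i) with hα
  set K := fld α with hK
  haveI : FiniteDimensional ℚ K := finiteDimensional_fld α halg
  have hαK : ∀ i, α i ∈ K := mem_fld α
  set a : Fin n → K := fun i => ⟨α i, hαK i⟩ with ha
  have hval : ∀ i, K.val (a i) = α i := fun i => rfl
  obtain ⟨D, hD0, hDint⟩ := exists_den α halg
  -- integrality inside `K`
  have haint : ∀ i, IsIntegral ℤ ((D : K) * a i) := by
    intro i
    obtain ⟨P, hPm, hP⟩ := hDint i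
    refine ⟨P, hPm, ?_⟩
    apply Subtype.val_injective
    have e : (((Polynomial.eval₂ (algebraMap ℤ K) ((D : K) * a i) P : K) : ℂ)) =
        K.val.toRingHom (Polynomial.eval₂ (algebraMap ℤ K) ((D : K) * a i) P) := rfl
    rw [e, Polynomial.hom_eval₂,
      RingHom.ext_int ((K.val.toRingHom).comp (algebraMap ℤ K)) (algebraMap ℤ ℂ)]
    simpa [hval] using hP
  -- a size constant `M ≥ 1` bounding all conjugates of the `a i`
  set M : ℝ := 1 + ∑ σ : K →ₐ[ℚ] ℂ, ∑ i, ‖σ (a i)‖ with hM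
  have hM1 : 1 ≤ M := by
    have : 0 ≤ ∑ σ : K →ₐ[ℚ] ℂ, ∑ i, ‖σ (a i)‖ := by positivity
    linarith
  have hMσ : ∀ (σ : K →ₐ[ℚ] ℂ) (i : Fin n), ‖σ (a i)‖ ≤ M := by
    intro σ i
    have h1 : ‖σ (a i)‖ ≤ ∑ j, ‖σ (a j)‖ :=
      single_le_sum (f := fun j => ‖σ (a j)‖) (fun j _ => norm_nonneg _) (mem_univ i)
    have h2 : ∑ j, ‖σ (a j)‖ ≤ ∑ τ : K →ₐ[ℚ] ℂ, ∑ j, ‖τ (a j)‖ :=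
      single_le_sum (f := fun τ : K →ₐ[ℚ] ℂ => ∑ j, ‖τ (a j)‖) (fun τ _ => by positivity)
        (mem_univ σ)
    linarith
  set h := Fintype.card (K →ₐ[ℚ] ℂ) with hh
  set G : ℝ := |(D : ℝ)| * M with hG
  have hD1 : (1 : ℝ) ≤ |(D : ℝ)| := by exact_mod_cast Int.one_le_abs hD0
  have hG1 : 1 ≤ G := by nlinarith
  have hDG : |(D : ℝ)| ≤ G := by nlinarith
  clear_value G
  -- the constant
  refine ⟨2 * 2 ^ (h + 1) * G ^ (n * (h + 1)), by positivity, ?_⟩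
  intro T t ht htT
  -- `T ≥ 1`
  obtain ⟨i₀, hi₀⟩ : ∃ i, t i ≠ 0 := by
    by_contra! hzero
    exact ht (funext hzero)
  have hT1 : 1 ≤ T := by
    have h1 := htT i₀
    have h2 := Int.one_le_abs hi₀
    omega
  set Ω := ∑ i, (t i : ℂ) * l i with hΩ
  -- `Ω ≠ 0` by the linear independence of the `l i`
  have hΩ0 : Ω ≠ 0 := by
    intro h0
    have key := Fintype.linearIndependent_iff.mp hli (fun i => (t i : ℚ)) ?_ i₀
    · exact hi₀ (by exact_mod_cast key)
    · have : ∑ i, ((t i : ℚ) • l i) = Ω := by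
        refine sum_congr rfl fun i _ => ?_
        rw [Rat.smul_def, Rat.cast_intCast]
      rw [this, h0]
  -- the trivial case `‖Ω‖ > 1`
  have hX1 : (1 : ℝ) ≤ 2 ^ (h + 1) * G ^ (n * (h + 1) * T) :=
    one_le_mul_of_one_le_of_one_le (one_le_pow₀ (by norm_num)) (one_le_pow₀ hG1)
  have hcT : 2 * (2 ^ (h + 1) * G ^ (n * (h + 1) * T)) ≤
      (2 * 2 ^ (h + 1) * G ^ (n * (h + 1))) ^ T := by
    have e1 : (2 : ℝ) ≤ 2 ^ T := by
      calc (2 : ℝ) = 2 ^ 1 := by norm_num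
        _ ≤ 2 ^ T := pow_le_pow_right₀ (by norm_num) hT1
    have e2 : (2 : ℝ) ^ (h + 1) ≤ 2 ^ ((h + 1) * T) :=
      pow_le_pow_right₀ (by norm_num) (Nat.le_mul_of_pos_right _ hT1)
    have e3 : (2 * 2 ^ (h + 1) * G ^ (n * (h + 1))) ^ T =
        2 ^ T * 2 ^ ((h + 1) * T) * G ^ (n * (h + 1) * T) := by
      rw [mul_pow, mul_pow, ← pow_mul, ← pow_mul]
    rw [e3, ← mul_assoc]
    exact mul_le_mul (mul_le_mul e1 e2 (by positivity) (by positivity)) le_rfl (by positivity)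
      (by positivity)
  suffices hmain : (1 : ℝ) ≤ 2 ^ (h + 1) * G ^ (n * (h + 1) * T) * ‖Ω‖ by
    have hXpos : (0 : ℝ) < 2 ^ (h + 1) * G ^ (n * (h + 1) * T) := by positivity
    have hΩge : (2 ^ (h + 1) * G ^ (n * (h + 1) * T))⁻¹ ≤ ‖Ω‖ := by
      rw [inv_le_iff_one_le_mul₀ hXpos]; linarith
    refine lt_of_lt_of_le ?_ hΩge
    apply inv_strictAnti₀ hXpos
    linarith
  by_cases hΩ1 : 1 < ‖Ω‖
  · nlinarith
  rw [not_lt] at hΩ1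
  -- positive and negative parts of the `t i`
  set p : Fin n → ℕ := fun i => (t i).toNat with hp
  set m : Fin n → ℕ := fun i => (-t i).toNat with hm
  have hpm : ∀ i, (t i : ℂ) = (p i : ℂ) - (m i : ℂ) := by
    intro i
    have := Int.toNat_sub_toNat_neg (t i)
    rw [← this]
    push_cast [hp, hm]
    ring
  have hpmT : ∀ i, p i + m i ≤ T := by
    intro i
    have h1 := Int.toNat_add_toNat_neg_eq_natAbs (t i)
    have h2 := htT i
    simp only [hp, hm]
    zify
    rw [Int.abs_eq_natAbs] at h2
    omega
  have hsT : ∑ i, (p i + m i) ≤ n * T := by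
    calc ∑ i, (p i + m i) ≤ ∑ _i : Fin n, T := sum_le_sum fun i _ => hpmT i
      _ = n * T := by simp
  -- the algebraic integer `ω`
  set ω : K := (∏ i, ((D : K) * a i) ^ p i) * (∏ i, (D : K) ^ m i) -
      (∏ i, ((D : K) * a i) ^ m i) * (∏ i, (D : K) ^ p i) with hω
  have hDKint : IsIntegral ℤ (D : K) := by exact_mod_cast isIntegral_algebraMap (R := ℤ) (A := K)
  have hωint : IsIntegral ℤ ω := by
    refine IsIntegral.sub ?_ ?_
    · exact (IsIntegral.prod _ fun i _ => (haint i).pow _).mul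
        (IsIntegral.prod _ fun i _ => hDKint.pow _)
    · exact (IsIntegral.prod _ fun i _ => (haint i).pow _).mul
        (IsIntegral.prod _ fun i _ => hDKint.pow _)
  -- its complex value
  set B : ℂ := ∏ i, α i ^ m i with hB
  have hB0 : B ≠ 0 := prod_ne_zero_iff.mpr fun i _ => pow_ne_zero _ (Complex.exp_ne_zero _)
  have hA : ∏ i, α i ^ p i = cexp Ω * B := by
    have e1 : ∏ i, α i ^ p i = cexp (∑ i, (p i : ℂ) * l i) := by
      rw [Complex.exp_sum]; exact prod_congr rfl fun i _ => (Complex.exp_nat_mul _ _).symm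
    have e2 : B = cexp (∑ i, (m i : ℂ) * l i) := by
      rw [hB, Complex.exp_sum]; exact prod_congr rfl fun i _ => (Complex.exp_nat_mul _ _).symm
    rw [e1, e2, ← Complex.exp_add]
    congr 1
    rw [hΩ, ← sum_add_distrib]
    exact sum_congr rfl fun i _ => by rw [hpm]; ring
  have hωC : (ω : ℂ) = (D : ℂ) ^ (∑ i, (p i + m i)) * B * (cexp Ω - 1) := by
    have e : (ω : ℂ) = K.val ω := rfl
    rw [e, hω]
    simp only [map_sub, map_mul, map_prod, map_pow, map_intCast, hval]
    simp_rw [mul_pow, prod_mul_distrib, prod_pow_eq_pow_sum]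
    rw [hA, ← hB, sum_add_distrib, pow_add]
    ring
  -- bound for the conjugates
  have hconj : ∀ σ : K →ₐ[ℚ] ℂ, ‖σ ω‖ ≤ 2 * G ^ (n * T) := by
    intro σ
    rw [hω, map_sub]
    refine (norm_sub_le _ _).trans ?_
    have hprod1 : ∀ e : Fin n → ℕ, ‖σ (∏ i, ((D : K) * a i) ^ e i)‖ ≤ G ^ ∑ i, e i := by
      intro e
      simp only [map_prod, map_pow, map_mul, map_intCast, norm_prod, norm_pow, norm_mul,
        Complex.norm_intCast]
      rw [← prod_pow_eq_pow_sum]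
      refine prod_le_prod (fun i _ => by positivity) fun i _ => ?_
      refine pow_le_pow_left₀ (by positivity) ?_ _
      rw [hG]
      have : |((D : ℤ) : ℝ)| = |(D : ℝ)| := rfl
      exact mul_le_mul_of_nonneg_left (hMσ σ i) (abs_nonneg _)
    have hprod2 : ∀ e : Fin n → ℕ, ‖σ (∏ i, (D : K) ^ e i)‖ ≤ G ^ ∑ i, e i := by
      intro e
      simp only [map_prod, map_pow, map_intCast, norm_prod, norm_pow, Complex.norm_intCast]
      rw [← prod_pow_eq_pow_sum]
      refine prod_le_prod (fun i _ => by positivity) fun i _ => ?_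
      exact pow_le_pow_left₀ (by positivity) hDG _
    have hGe : ∀ k ≤ n * T, G ^ k ≤ G ^ (n * T) := fun k hk => pow_le_pow_right₀ hG1 hk
    have hs1 : ∑ i, p i + ∑ i, m i ≤ n * T := by rw [← sum_add_distrib]; exact hsT
    calc ‖σ ((∏ i, ((D : K) * a i) ^ p i) * ∏ i, (D : K) ^ m i)‖ +
          ‖σ ((∏ i, ((D : K) * a i) ^ m i) * ∏ i, (D : K) ^ p i)‖
        ≤ G ^ (∑ i, p i) * G ^ (∑ i, m i) + G ^ (∑ i, m i) * G ^ (∑ i, p i) := by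
          rw [map_mul, map_mul, norm_mul, norm_mul]
          gcongr
          · exact hprod1 p
          · exact hprod2 m
          · exact hprod1 m
          · exact hprod2 p
      _ ≤ G ^ (n * T) + G ^ (n * T) := by
          rw [← pow_add, ← pow_add]
          exact add_le_add (hGe _ hs1) (hGe _ (by omega))
      _ = 2 * G ^ (n * T) := by ring
  by_cases hω0 : ω = 0
  · -- then `e^Ω = 1`, so `Ω` is a non-zero multiple of `2πi`, contradicting `‖Ω‖ ≤ 1`
    exfalso
    have h1 : cexp Ω = 1 := by
      have : (D : ℂ) ^ (∑ i, (p i + m i)) * B * (cexp Ω - 1) = 0 := by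
        rw [← hωC, hω0]; rfl
      have hD' : (D : ℂ) ^ (∑ i, (p i + m i)) ≠ 0 := pow_ne_zero _ (by exact_mod_cast hD0)
      rcases mul_eq_zero.mp this with h | h
      · rcases mul_eq_zero.mp h with h' | h'
        · exact absurd h' hD'
        · exact absurd h' hB0
      · exact sub_eq_zero.mp h
    obtain ⟨k, hk⟩ := Complex.exp_eq_one_iff.mp h1
    have hk0 : k ≠ 0 := by
      rintro rfl
      simp at hk
      exact hΩ0 hk
    have hnorm : ‖Ω‖ = |(k : ℝ)| * (2 * Real.pi) := by
      rw [hk, norm_mul, Complex.norm_intCast]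
      simp [Complex.norm_real, abs_of_pos Real.pi_pos]
    have hk1 : (1 : ℝ) ≤ |(k : ℝ)| := by exact_mod_cast Int.one_le_abs hk0
    have := Real.pi_gt_three
    nlinarith
  · have hL := one_le_norm_mul_pow K hωint hω0 (B := 2 * G ^ (n * T))
      (by nlinarith [one_le_pow₀ (n := n * T) hG1]) hconj
    -- `‖ω‖ ≤ 2 G^{nT} ‖Ω‖`
    have hωle : ‖(ω : ℂ)‖ ≤ 2 * G ^ (n * T) * ‖Ω‖ := by
      rw [hωC, norm_mul, norm_mul, norm_pow, Complex.norm_intCast]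
      have e1 : |((D : ℤ) : ℝ)| ^ (∑ i, (p i + m i)) ≤ |(D : ℝ)| ^ (n * T) :=
        pow_le_pow_right₀ hD1 hsT
      have e2 : ‖B‖ ≤ M ^ (n * T) := by
        rw [hB, norm_prod]
        calc ∏ i, ‖α i ^ m i‖ ≤ ∏ i, M ^ m i := by
              refine prod_le_prod (fun i _ => norm_nonneg _) fun i _ => ?_
              rw [norm_pow]
              exact pow_le_pow_left₀ (norm_nonneg _) (by rw [← hval]; exact hMσ K.val i) _
          _ = M ^ ∑ i, m i := prod_pow_eq_pow_sum _ _ _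
          _ ≤ M ^ (n * T) := pow_le_pow_right₀ hM1 (by
              have : ∑ i, m i ≤ ∑ i, (p i + m i) := sum_le_sum fun i _ => by omega
              omega)
      have e3 : ‖cexp Ω - 1‖ ≤ 2 * ‖Ω‖ := Complex.norm_exp_sub_one_le hΩ1
      calc |((D : ℤ) : ℝ)| ^ (∑ i, (p i + m i)) * ‖B‖ * ‖cexp Ω - 1‖
          ≤ |(D : ℝ)| ^ (n * T) * M ^ (n * T) * (2 * ‖Ω‖) := by
            gcongr
        _ = 2 * G ^ (n * T) * ‖Ω‖ := by rw [hG, mul_pow]; ring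
    -- combine
    calc (1 : ℝ) ≤ ‖(ω : ℂ)‖ * (2 * G ^ (n * T)) ^ h := hL
      _ ≤ 2 * G ^ (n * T) * ‖Ω‖ * (2 * G ^ (n * T)) ^ h :=
          mul_le_mul_of_nonneg_right hωle (by positivity)
      _ = 2 ^ (h + 1) * G ^ (n * (h + 1) * T) * ‖Ω‖ := by ring



end L6

/-- **Baker 1975, Ch. 2, Lemma 6, proved**: the named fact `Lemma6` holds.
[cite: Baker1975, Ch. 2 Lemma 6] -/
theorem lemma6_holds : Lemma6 := L6.lemma6_holds_aux

end Literature.NumberTheory.Transcendental.Baker1975
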